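import Summits.QuantumFields.BalabanUV.Beta.EriceFlowEnclosureB12AsPrintedHistoryContagionShiftFlowPicardOpen
import Summits.QuantumFields.BalabanUV.Beta.EriceFlowEnclosureB12AsPrintedHistoryContagionShiftFlowPicardEnd

/-!
# Beta / EriceFlowEnclosureB12AsPrintedHistoryContagionShiftFlowPicardOpenEnd — ASYMPTOTIC FREEDOM IS CONTAGIOUS, part 20 (the open END): on the as-printed carrier,
# [I] THEOREM 2 AS TYPED for ONE Setting S (+ the binder `hrg` + NE4 + coupling-chart fading memory, θ < 1, box ]0, γ_u] of ANY size) makes the renormalization group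
# equation of EVERY NEARBY LIMIT FUNCTIONAL well posed near zero renormalized coupling: for every torus exponent m there are η₀ > 0 and g₁₃ ≥ g₁₄ > 0 such that for EVERY
# functional B′ with memory profile (C, θ) on the box and `|betaInf S.β u − B′ u| ≤ η ≤ η₀` for all box u: from every pin g ∈ ]0, g₁₃] node U2's flow with memory of B′
# has a box solution, asymptotically free at rate ≥ β′ > 0, the scale-wise limit of node U2's `iterate B′ g` (lattice-free), and from every pin g ∈ ]0, g₁₄] EXACTLY ONE box
# solution.  Theorem 2 is NOT asked of the perturbation, nor any floor, sign or asymptotic-freedom letter: part 19's openness read at part 15's as-printed reference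
# (β-flow team, prover 1, unit `b2b-balaban-beta-bflow-p1`, gen 37; ROW AP-I·Uc × NODE U2)

HONEST FRAMING (page 1 of everything the β sub-cell writes): discharging `BetaPertH` makes Bałaban's UV stability UNCONDITIONAL — a
real constructive-QFT result; it is NOT the continuum limit and NOT the Clay problem.  HONEST DEPENDENCY (cell reorg 2026-08-19,
verbatim): «continuum YM on T⁴ ⇐ BetaPertH ∧ nine spine estimates (0/9 proved); BetaPertH ⇐ (D1) ∧ (D4) ∧ CAP+tail; G-an2-4 gates
asym, D1 and NE2/3/4.»  THIS MODULE DISCHARGES NOTHING: a junction BY NAME of part 19 (`exists_memFlow_of_close`, `existsUnique_memFlow_of_close`) with part 15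
(`reference_of_typedTheorem2`), part 13 (`iterate_eq_picardIter`), part 11 (`flow_threshold_exists`) and node U2's `T4BetaStationary.memoryProfile_betaInf`, over the NAMED FIELDS of
`B12BetaAsPrinted` ([I] = T. Bałaban, Commun. Math. Phys. **109** (1987) [Balaban1987RG1]): `Theorem2Statement S hL` (STATED WITHOUT PROOF in print, p. 259; a HYPOTHESIS),
the binder `hrg`.  `ScaleShiftRate` (NE4; NOT PRINTED, GAPS G-t4-U2-1) and `HistLipschitz` ∕ `FadingMemory` (NOT PRINTED, GAPS G-t4-U2-2) are LETTERS on `S.β`; the nearby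
functional B′ and its η-closeness are HYPOTHESES about an abstract object; NOTHING is asserted about Bałaban's β.

WHAT THIS FILE PROVES (0 sorry, 0 def): **`af_solution_nearby_of_typedTheorem2`** (existence, AF rate, lattice-free limit for every nearby B′ and every small pin),
**`wellPosed_nearby_of_typedTheorem2`** (plus `∃!` below a second threshold).  NOT CLAIMED: anything about Bałaban's β; Theorem 2; `BetaPertH`; the continuum limit of the
measures; Clay.
-/

namespace Summit.QuantumFields.BalabanUV.Beta.EriceFlowEnclosureB12AsPrintedHistoryContagionShiftFlowPicardOpenEnd

open Finset Filter Topology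
open Literature.MathematicalPhysics.QuantumFieldTheory.Balaban1983to89
open Literature.MathematicalPhysics.QuantumFieldTheory.Balaban1983to89.B12BetaAsPrinted
open Literature.MathematicalPhysics.QuantumFieldTheory.Balaban1983to89.FlowStep (RGEqH)
open Literature.MathematicalPhysics.QuantumFieldTheory.Balaban1983to89.T4CouplingMatching (HistLipschitz FadingMemory ScaleShiftRate)
open Literature.MathematicalPhysics.QuantumFieldTheory.Balaban1983to89.T4BetaStationary (SeqBox MemoryProfile betaInf memoryProfile_betaInf)
open Literature.MathematicalPhysics.QuantumFieldTheory.Balaban1983to89.T4BetaFlowWellPosed (MemFlow iterate picard)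
open Summit.QuantumFields.BalabanUV.Beta.EriceFlowEnclosureB12AsPrintedHistoryContagionShiftFlowEnd (flow_threshold_exists)
open Summit.QuantumFields.BalabanUV.Beta.EriceFlowEnclosureB12AsPrintedHistoryContagionShiftFlowPicardLimit (iterate_eq_picardIter)
open Summit.QuantumFields.BalabanUV.Beta.EriceFlowEnclosureB12AsPrintedHistoryContagionShiftFlowPicardEnd (reference_of_typedTheorem2)
open Summit.QuantumFields.BalabanUV.Beta.EriceFlowEnclosureB12AsPrintedHistoryContagionShiftFlowPicardOpen (exists_memFlow_of_close existsUnique_memFlow_of_close)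

noncomputable section

variable {S : Setting}

/-- **EVERY NEARBY LIMIT FUNCTIONAL HAS ASYMPTOTICALLY FREE SOLUTIONS NEAR ZERO — FROM THEOREM 2 AS TYPED FOR ONE SETTING.**  `Theorem2Statement S hL` (a HYPOTHESIS), the binder
`hrg` on ]0, γ_u], NE4 `ScaleShiftRate c θ γ_u S.β`, `HistLipschitz Λ γ_u S.β` with `FadingMemory C θ Λ` (0 < θ < 1, C ≥ 0, c ≥ 0) ⟹ for every torus exponent m there are η₀ > 0,
g₁₃ > 0 and a rate β′ > 0 such that for EVERY functional B′ with `MemoryProfile C θ γ_u B′` and `|betaInf S.β u − B′ u| ≤ η ≤ η₀` for all box u, and every pin g ∈ ]0, g₁₃]: node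
U2's flow with memory OF B′ has a box solution h′ from g with `1∕(4g²) + β′·m′ ≤ 1∕h′(m′)²`, and node U2's lattice-free `iterate B′ g n m′ → h′(m′)` (part 19 with the as-printed
reference of part 15: η₀ = b∕8, β′ = b∕8 from the reference's rate b). [cite: Balaban1987RG1, Thm 2 (0.31) p.259 with (0.20) p.256 and §5 p.298] -/
theorem af_solution_nearby_of_typedTheorem2 {hL : Odd S.L ∧ 1 < S.L} (h : Theorem2Statement S hL)
    {γu θ C c : ℝ} {Λ : ℕ → ℕ → ℝ} (hγu : 0 < γu)
    (hrg : ∀ P : B12.RunParams, Step.InInterval γu P.K (S.cpl P) → RGEqH P.K S.β (S.cpl P))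
    (hS : ScaleShiftRate c θ γu S.β) (hL' : HistLipschitz Λ γu S.β) (hΛ : FadingMemory C θ Λ)
    (hθ0 : 0 < θ) (hθ1 : θ < 1) (hC : 0 ≤ C) (hc : 0 ≤ c) (m : ℕ) :
    ∃ η₀ g₁₃ b' : ℝ, 0 < η₀ ∧ 0 < g₁₃ ∧ 0 < b' ∧ ∀ (B' : (ℕ → ℝ) → ℝ) (η : ℝ), MemoryProfile C θ γu B' →
      (∀ u : ℕ → ℝ, SeqBox γu u → |betaInf S.β u - B' u| ≤ η) → η ≤ η₀ →
      ∀ e : ℝ, 0 < e → e ≤ g₁₃ → ∃ h' : ℕ → ℝ, SeqBox γu h' ∧ MemFlow B' e h' ∧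
        (∀ m' : ℕ, 1 / (4 * e ^ 2) + b' * (m' : ℝ) ≤ 1 / (h' m') ^ 2) ∧
        ∀ m', Tendsto (fun n => iterate B' e n m') atTop (𝓝 (h' m')) := by
  have h1θ : 0 < 1 - θ := by linarith
  have hB := memoryProfile_betaInf hS hL' hΛ hθ0.le hθ1
  obtain ⟨gr, b, -, -, t, hgr, hb, -, -, htbox, htflow, hprof, -, -⟩ := reference_of_typedTheorem2 h hγu hrg hS hL' hΛ hθ0 hθ1 hC hc m
  have h2gr : 0 < 2 * gr := by positivity
  obtain ⟨e₀, he₀, hthr⟩ := flow_threshold_exists (1 / gr ^ 2 + C * γu / (1 - θ) ^ 2 + (2 * C / ((1 - θ) * b)) ^ 2) hC hθ1 hb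
  refine ⟨b / 8, min e₀ (γu / 2), b / 8, by positivity, lt_min he₀ (by positivity), by positivity, fun B' η hB' hη hηle e he hle => ?_⟩
  obtain ⟨hs1, hs2, hs4⟩ := hthr e he (hle.trans (min_le_left _ _))
  have h2e : 2 * e ≤ γu := by linarith [hle.trans (min_le_right _ _)]
  have hη4 : 4 * η < b := by linarith
  have hus : SeqBox γu (fun _ : ℕ => e) := fun _ => ⟨he, by linarith⟩
  have henv : ∀ q : ℕ, (fun _ : ℕ => e) q ≤ 2 * e := fun _ => by simp only; linarith
  obtain ⟨h', hhs', hhf', hprof', hlim⟩ :=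
    exists_memFlow_of_close hB hB' hC hθ0.le hθ1 hb h2gr htbox htflow hprof hη hη4 he h2e hus henv hs1 hs2 hs4
  refine ⟨h', hhs', hhf', fun m' => ?_, fun m' => (hlim m').congr fun n => by rw [iterate_eq_picardIter]⟩
  have hrate : b / 8 * (m' : ℝ) ≤ (b - 4 * η) / 4 * (m' : ℝ) := mul_le_mul_of_nonneg_right (by linarith) (Nat.cast_nonneg m')
  linarith [hprof' m']

/-- **… AND EXACTLY ONE BOX SOLUTION BELOW A SECOND THRESHOLD (well-posedness of every nearby flow).**  Under the data of `af_solution_nearby_of_typedTheorem2`, for every m there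
are η₀ > 0 and g₁₄ > 0 such that for EVERY functional B′ with `MemoryProfile C θ γ_u B′`, `|betaInf S.β − B′| ≤ η ≤ η₀` on the box, and every pin g ∈ ]0, g₁₄]:
**`∃! h, SeqBox γ_u h ∧ MemFlow B′ g h`** — part 19's `existsUnique_memFlow_of_close`, B′'s own reference being its solution from the fixed pin g₁₃ (rate ≥ b∕8).  Node U2's
`existsUnique_memFlow` for a functional of which NOTHING but a memory profile and sup-closeness to `betaInf S.β` is known. [cite: Balaban1987RG1, Thm 2 (0.31) p.259 with (0.20) p.256 and §5 p.298] -/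
theorem wellPosed_nearby_of_typedTheorem2 {hL : Odd S.L ∧ 1 < S.L} (h : Theorem2Statement S hL)
    {γu θ C c : ℝ} {Λ : ℕ → ℕ → ℝ} (hγu : 0 < γu)
    (hrg : ∀ P : B12.RunParams, Step.InInterval γu P.K (S.cpl P) → RGEqH P.K S.β (S.cpl P))
    (hS : ScaleShiftRate c θ γu S.β) (hL' : HistLipschitz Λ γu S.β) (hΛ : FadingMemory C θ Λ)
    (hθ0 : 0 < θ) (hθ1 : θ < 1) (hC : 0 ≤ C) (hc : 0 ≤ c) (m : ℕ) :
    ∃ η₀ g₁₄ : ℝ, 0 < η₀ ∧ 0 < g₁₄ ∧ ∀ (B' : (ℕ → ℝ) → ℝ) (η : ℝ), MemoryProfile C θ γu B' →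
      (∀ u : ℕ → ℝ, SeqBox γu u → |betaInf S.β u - B' u| ≤ η) → η ≤ η₀ →
      ∀ e : ℝ, 0 < e → e ≤ g₁₄ → ∃! h' : ℕ → ℝ, SeqBox γu h' ∧ MemFlow B' e h' := by
  have h1θ : 0 < 1 - θ := by linarith
  have hB := memoryProfile_betaInf hS hL' hΛ hθ0.le hθ1
  obtain ⟨gr, b, -, -, t, hgr, hb, -, -, htbox, htflow, hprof, -, -⟩ := reference_of_typedTheorem2 h hγu hrg hS hL' hΛ hθ0 hθ1 hC hc m
  have h2gr : 0 < 2 * gr := by positivity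
  obtain ⟨e₀, he₀, hthr⟩ := flow_threshold_exists (1 / gr ^ 2 + C * γu / (1 - θ) ^ 2 + (2 * C / ((1 - θ) * b)) ^ 2) hC hθ1 hb
  -- the fixed reference pin for the perturbed functionals
  set g₁₃ : ℝ := min e₀ (γu / 2) with hg₁₃
  have hg₁₃0 : 0 < g₁₃ := lt_min he₀ (by positivity)
  obtain ⟨hs1, hs2, hs4⟩ := hthr g₁₃ hg₁₃0 (min_le_left _ _)
  have h2g : 2 * g₁₃ ≤ γu := by linarith [min_le_right e₀ (γu / 2)]
  -- the second threshold, uniform over η ≤ b∕8 through the rate floor b∕8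
  have hb8 : 0 < b / 8 := by positivity
  obtain ⟨e₁, he₁, hthr'⟩ := flow_threshold_exists (1 / g₁₃ ^ 2 + C * γu / (1 - θ) ^ 2 + (2 * C / ((1 - θ) * (b / 8))) ^ 2) hC hθ1 hb8
  refine ⟨b / 8, min e₁ (γu / 2), hb8, lt_min he₁ (by positivity), fun B' η hB' hη hηle e he hle => ?_⟩
  have hη4 : 4 * η < b := by linarith
  have hbr : b / 8 ≤ (b - 4 * η) / 4 := by linarith
  have hbr0 : 0 < (b - 4 * η) / 4 := hb8.trans_le hbr
  obtain ⟨hs1', hs2', hs4'⟩ := hthr' e he (hle.trans (min_le_left _ _))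
  have h2e : 2 * e ≤ γu := by linarith [hle.trans (min_le_right _ _)]
  -- weaken the e-conditions from the rate floor b∕8 to the actual rate (b − 4η)∕4
  have hs1'' : 4 * C * e ≤ (b - 4 * η) / 4 * (1 - θ) := hs1'.trans (mul_le_mul_of_nonneg_right hbr h1θ.le)
  have hQ : 1 / g₁₃ ^ 2 + C * γu / (1 - θ) ^ 2 + (2 * C / ((1 - θ) * ((b - 4 * η) / 4))) ^ 2
      ≤ 1 / g₁₃ ^ 2 + C * γu / (1 - θ) ^ 2 + (2 * C / ((1 - θ) * (b / 8))) ^ 2 := by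
    have h1 : 2 * C / ((1 - θ) * ((b - 4 * η) / 4)) ≤ 2 * C / ((1 - θ) * (b / 8)) :=
      div_le_div_of_nonneg_left (by positivity) (by positivity) (mul_le_mul_of_nonneg_left hbr h1θ.le)
    have h0 : 0 ≤ 2 * C / ((1 - θ) * ((b - 4 * η) / 4)) := by positivity
    nlinarith [pow_le_pow_left₀ h0 h1 2]
  have hs2'' : e ^ 2 * (1 / g₁₃ ^ 2 + C * γu / (1 - θ) ^ 2 + (2 * C / ((1 - θ) * ((b - 4 * η) / 4))) ^ 2) ≤ 3 / 4 :=
    (mul_le_mul_of_nonneg_left hQ (sq_nonneg e)).trans hs2'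
  exact existsUnique_memFlow_of_close hB hB' hC hθ0.le hθ1 hb h2gr htbox htflow hprof hη hη4 hg₁₃0 h2g hs1 hs2 hs4 he h2e hs1'' hs2'' hs4'

end

end Summit.QuantumFields.BalabanUV.Beta.EriceFlowEnclosureB12AsPrintedHistoryContagionShiftFlowPicardOpenEnd
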